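import Summits.ResolutionOfSingularities.ResolutionOfSingularities.Theorems.WildConesClassicalRegimesDefs
import Mathlib.Algebra.CharP.Defs
import HarnessLib

/-!
# [OURS · L1 W4.6, rung (ii)] STATEMENTS of the threefold-hypersurface forced-regime rung (instance p = 2 proved) over route WildCones'
# point-blow-up dynamics — campaign s46 of cell res-hironaka (LADDER-RESOLUTION rung L, D-0089); host route WildCones,
# `--kind definition --supports stmt-ResolutionOfSingularities-16884` (`ClassicalRegimes`)

HONEST FRAMING. Everything below is OURS (campaign statements of slot W4.6, typed by res-L1-type-o1 in the statement-only
lane on the hand-over of prover res-L1-s46-pv-4, STATUS 2026-08-26T21:07:44Z «proposed ITEM signature for rung (ii)@p=2 (host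
WildCones, name CampaignW46ThreefoldsCharTwo): …») over route WildCones' typed point-blow-up dynamics
(`Theorems/WildConesClassicalRegimesDefs.lean`: `WildCones.run`, `Isol`, `MultP`, `mu`, `InfRun`, `MuDrop`). NOTHING here is
a statement of H. Hironaka's manuscript [Hironaka2017] and nothing is asserted: the three decls are predicates `def … (p …) : Prop`. Their
PROOFS are res-L1-s46-pv-4's `Theorems/WildConesCampaignW46ThreefoldsCharTwo.lean` (p467896 ACCEPTED:
`CampaignW46.ThreefoldsCharTwo.threefold_exists_exit_le_mu`, `threefold_not_infRun`, `muDrop_two`) — this file only NAMES the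
statements so that (a) the slot planner can register the rank-9 item with a signature that is a single constant and close
it `--by` the prover's theorem, and (b) the OURS lanes sign ONE decl per rung statement. RELATION TO THE TYPED PROCEDURE
(§16, `Theorems/MarkedTransferCampaignW46TypedProcedure.lean`): these statements live on the route's dynamics of the
HEIGHT-ONE hypersurface `z^p + a(u)` under point blow-ups (the FORCED regime: isolated singularity, the point is the only
admissible centre), not on the §15 résumés; the bridge «in the forced regime the typed centre rule is deterministic»
is pv-4's companion `Theorems/MarkedTransferCampaignW46ForcedRegime.lean` (p468369). AI review is weaker than expert review.
No `sorry`, no theorem.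

## Decls (namespace `…Theorems`)

* `CampaignW46ThreefoldsForcedExit p` — [OURS · L1 W4.6 (ii)] THE RUNG STATEMENT as a predicate in the characteristic `p`; its
  instance `p = 2` is pv-4's proposed signature VERBATIM: over every field `κ` of characteristic `2`, every run of the
  point-blow-up dynamics of a double point `z² + a(u₁,u₂,u₃)` (any start `c₀`, chart word `i`, translation word `t`) leaves the
  forced double regime (isolated ∧ multiplicity 2) within `μ(c₀)` steps — an EFFECTIVE termination bound by OUR invariant, the
  Milnor number. (Predicates, not parameterless Props: a closed `def … : Prop` in a Theorems file is relocated by the gate as a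
  «fact»; the parameter also keeps odd `p` expressible as the OPEN instances they are.)
* `CampaignW46ThreefoldsNoInfRun p` — the weaker «no infinite forced run» form (`¬ WildCones.InfRun p 3 κ c₀ i t`).
* `CampaignW46HypersurfacesMuDrop p n` — the one-step form in every dimension `n`: `WildCones.MuDrop p n κ` (strict μ-drop at
  every forced step; the Eq. (127)-ROLE statement of this rung, with μ in place of the manuscript's string).

VACUITY. Not vacuous: forced double states exist (e.g. `z² + u₁u₂ + u₃³` over `𝔽₂`), `μ` is finite exactly under `Isol`;
the only parameters are the characteristic `p` (and `n`), no notion parameters (no junk-instance reading). They do NOT need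
`[PerfectField κ]`.

## References

* res-L1-s46-pv-4, STATUS 2026-08-26T21:07:44Z (hand-over, proposed signature); Theorems/WildConesCampaignW46ThreefoldsCharTwo.lean
  (p467896), Theorems/MarkedTransferCampaignW46ForcedRegime.lean (p468369); route file Theses/WildCones.lean (`ClassicalRegimes`,
  stmt-16884); plan/SIZED-ASK-L.md v0.2 §S S-s46 (rung (ii)).
* G.-M. Greuel, G. Pfister (hyperbolic splitting in characteristic 2) as used by the tree's `MuDropCharTwoOrdP` — context for
  the proofs, not a premise of these statements.
-/

noncomputable section

set_option linter.dupNamespace false -- mandated namespace of this single-conjunct summit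

namespace Summit.ResolutionOfSingularities.ResolutionOfSingularities.Theorems

/-- [OURS · L1 W4.6 rung (ii)] replaces the role of the termination half of Th. 16.13 p.87 l.26–28 for THREEFOLD HYPERSURFACE
`p`-FOLD POINTS in characteristic `p`, in the forced (isolated) regime of route WildCones' point-blow-up dynamics, WITH AN
EFFECTIVE BOUND; NOT a statement of the manuscript. For every field `κ` of characteristic `p`, every start
`c₀ : (Fin 3 → ℕ) → κ` (coefficients of `a(u₁,u₂,u₃)` in `z^p + a`), every chart word `i` and translation word `t`, some stage
`m ≤ μ(c₀)` of the run is NOT a forced state (not both isolated and of multiplicity `p`). A PREDICATE in the characteristic `p`: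
the instance `p = 2` is res-L1-s46-pv-4's proposed item signature VERBATIM (STATUS 2026-08-26T21:07:44Z) and is PROVED by
`CampaignW46.ThreefoldsCharTwo.threefold_exists_exit_le_mu` (p467896); other `p` are not claimed by anyone here. [folklore] -/
def CampaignW46ThreefoldsForcedExit (p : ℕ) : Prop :=
  ∀ (κ : Type) [Field κ] [CharP κ p] (c₀ : (Fin 3 → ℕ) → κ) (i : ℕ → Fin 3) (t : ℕ → Fin 3 → κ),
    ∃ m ≤ WildCones.mu p 3 κ c₀,
      ¬ (WildCones.Isol p 3 κ (WildCones.run p 3 κ c₀ i t m) ∧ WildCones.MultP p 3 κ (WildCones.run p 3 κ c₀ i t m))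

/-- [OURS · L1 W4.6 rung (ii), weak form] «no infinite forced run» for threefold hypersurface `p`-fold points in characteristic
`p`: `¬ WildCones.InfRun p 3 κ c₀ i t` for every field `κ` of characteristic `p` and all `c₀, i, t`. Predicate in `p`; the
instance `p = 2` is PROVED by `CampaignW46.ThreefoldsCharTwo.threefold_not_infRun` (p467896). NOT a statement of the
manuscript. [folklore] -/
def CampaignW46ThreefoldsNoInfRun (p : ℕ) : Prop :=
  ∀ (κ : Type) [Field κ] [CharP κ p] (c₀ : (Fin 3 → ℕ) → κ) (i : ℕ → Fin 3) (t : ℕ → Fin 3 → κ),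
    ¬ WildCones.InfRun p 3 κ c₀ i t

/-- [OURS · L1 W4.6 rung (ii), one-step form] replaces the role of Th. 16.6 (2) / Eq. (127) p.84 l.10–20 for hypersurface
`p`-fold points `z^p + a(u₁, …, uₙ)` in characteristic `p` with OUR invariant the Milnor number: at every forced step of the
point-blow-up dynamics `μ` strictly drops (`WildCones.MuDrop p n κ`) for every field `κ` of characteristic `p`. Predicate in
`(p, n)`; the instances `(2, n)` for EVERY `n` are PROVED by `CampaignW46.ThreefoldsCharTwo.muDrop_two` (p467896); for odd `p`
the tree's `WildCones.ClassicalRegimes_proof` line covers `n ≤ 2` only. NOT a statement of the manuscript. [folklore] -/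
def CampaignW46HypersurfacesMuDrop (p n : ℕ) : Prop :=
  ∀ (κ : Type) [Field κ] [CharP κ p], WildCones.MuDrop p n κ

end Summit.ResolutionOfSingularities.ResolutionOfSingularities.Theorems

end
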